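import Summits.ResolutionOfSingularities.ResolutionOfSingularities.Theorems.PurelyInseparableDim4NarrowPullback
import HarnessLib
import HarnessLib.Audit.Tags

/-!
# Purely inseparable dim 4 — EXCEPTIONAL LENGTH DROPS: the exact laws (U) and (NT) of the wide core

Sequel of `PurelyInseparableDim4NarrowPullback` (L2 = Kollár's pullback containment in characteristic `p`,
p661331).  CARD I-3-11 of cell `res-dim4-pi` (seat idea-3, «the wide core as a plane fat point») states two exact
laws for one point blow-up `F ↦ F'` of a presented state of order `≥ p` (chart `j`, point `b` with `b_j = 0`,
`F' = (CentreBlowup.step p univ j b s).F` the CLEANED transform, `σ = σ_{j,b}` the chart substitution,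
`J_p⁺ = singLocusIdeal p`, `𝔪₀ = originIdeal`):

* **(U) «the exceptional length drops»** — `x_j^ℓ ∈ J_p⁺(F) + 𝔪₀^M ⇒ x_j^{ℓ−1} ∈ J_p⁺(F') + 𝔪₀^{M−1}`
  (`X_pow_pred_mem_of_X_pow_mem`): ANY point `b` of the exceptional hyperplane, no equimultiplicity, no
  isolation.  Read at all levels `M` this is `x_j^ℓ ∈ Ĵ⁺(F) ⇒ x_j^{ℓ−1} ∈ Ĵ⁺(F')`, the cancellation step of the
  (N1) assembly (CARD I-3-10: `μ⁺(F') ≤ μ⁺(F) − 1` on narrow edges).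
* **(NT) «non-tangent moves»** — if some `g ∈ J_p⁺(F) + 𝔪₀^M` pulls back to `σ^* g = x_j^o · h` with
  `h(0) ≠ 0`, then `x_j^{o−1} ∈ J_p⁺(F') + 𝔪₀^{M−1}` (`X_pow_pred_mem_of_aeval_eq_mul_unit`; again any `b`).

Both are instances of the MASTER law `X_pow_mul_mem_of_aeval_eq`: `g ∈ J_p⁺(F) + 𝔪₀^M`, `σ^*g = x_j^o h`
`⇒ x_j^{o−1} h ∈ J_p⁺(F') + (x_j^{M−1})` — L2 (`NarrowPullback.aeval_mem_X_mul_singLocusIdeal`),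
`σ^*(𝔪₀^M) ⊆ (x_j^M)` (`NarrowPullback.map_originIdeal_pow_le`), and cancellation of ONE `x_j` in the domain
`K[x]` — followed, for (NT), by the unit cancellation `mem_sup_pow_of_mul_mem` (`h = c(1 + u)`, `u ∈ 𝔪₀`, a
geometric sum inverts `1 + u` modulo `𝔪₀^M`; no hypothesis on `J`).

[cite: Kollar2007, (3.75.1)–(3.75.3) and Theorem 3.76 (derivative ideals under blow-up; char p, m = p)]
OURS · counted 0 · the corollaries of (NT) that read the ridge (idea-3: `o = 2` ⇒ successor not wide; wide
successor ⇒ `o' ≤ o − 1`) are NOT here (they need the apolarity file of the (N1) line and the fat-point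
definitions).  Nothing here proves `NoWideTrap`, `NoIsolatedTrap 3 3`, or resolution of singularities in
dimension `≥ 4` / characteristic `p`.  Supports stmt-ResolutionOfSingularities-16155 (helper).
bears_on: LADDER-RESOLUTION:D157-DOOR2 (res-dim4-pi · E2(3,3) wide core · I-3-11 (U)/(NT)).
-/

set_option linter.dupNamespace false -- mandated namespace of this single-conjunct summit

namespace Summit.ResolutionOfSingularities.ResolutionOfSingularities.Theorems.PIDim4

namespace ExceptionalLength

open MvPolynomial Finset
open Literature.AlgebraicGeometry
open Literature.AlgebraicGeometry.Resolution

variable {K : Type} [Field K]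

/-! ## 1. Unit cancellation modulo `𝔪₀^M` -/

/-- A polynomial with vanishing constant term lies in `𝔪₀`. [folklore] -/
theorem mem_originIdeal_of_constantCoeff_eq_zero {u : MvPolynomial (Fin 4) K}
    (hu : constantCoeff u = 0) : u ∈ originIdeal K := by
  rw [originIdeal, RingHom.mem_ker, MvPolynomial.eval_zero]
  exact hu

/-- **Unit cancellation.**  If `h(0) ≠ 0` and `x·h ∈ J + 𝔪₀^M` (any ideal `J`), then `x ∈ J + 𝔪₀^M`:
write `h = c·(1 + u)` with `u ∈ 𝔪₀`; then `(1 + u)·Σ_{i<M} (−u)^i = 1 − (−u)^M` and `x·(−u)^M ∈ 𝔪₀^M`.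
[folklore] -/
theorem mem_sup_pow_of_mul_mem {J : Ideal (MvPolynomial (Fin 4) K)}
    {x h : MvPolynomial (Fin 4) K} (hh : constantCoeff h ≠ 0) {M : ℕ}
    (hx : x * h ∈ J ⊔ originIdeal K ^ M) : x ∈ J ⊔ originIdeal K ^ M := by
  set I : Ideal (MvPolynomial (Fin 4) K) := J ⊔ originIdeal K ^ M with hI
  set c : K := constantCoeff h with hc
  set u : MvPolynomial (Fin 4) K := C c⁻¹ * h - 1 with hu
  have hu0 : u ∈ originIdeal K := by
    apply mem_originIdeal_of_constantCoeff_eq_zero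
    rw [hu, map_sub, map_mul, constantCoeff_C, map_one, ← hc, inv_mul_cancel₀ hh, sub_self]
  have hh' : h = C c * (1 + u) := by
    rw [hu, add_sub_cancel, ← mul_assoc, ← C_mul, mul_inv_cancel₀ hh, C_1, one_mul]
  -- the geometric sum
  have hgeom : (1 + u) * ∑ i ∈ Finset.range M, (-u) ^ i = 1 - (-u) ^ M := by
    have := mul_neg_geom_sum (-u) M
    rwa [sub_neg_eq_add] at this
  have hpowM : x * (-u) ^ M ∈ I :=
    Ideal.mem_sup_right (Ideal.mul_mem_left _ _ (Ideal.pow_mem_pow ((originIdeal K).neg_mem hu0) M))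
  have hprod : x * h * (C c⁻¹ * ∑ i ∈ Finset.range M, (-u) ^ i) ∈ I := Ideal.mul_mem_right _ _ hx
  have hid : x * h * (C c⁻¹ * ∑ i ∈ Finset.range M, (-u) ^ i) = x - x * (-u) ^ M := by
    rw [hh']
    calc x * (C c * (1 + u)) * (C c⁻¹ * ∑ i ∈ Finset.range M, (-u) ^ i)
        = x * (C c * C c⁻¹) * ((1 + u) * ∑ i ∈ Finset.range M, (-u) ^ i) := by ring
      _ = x - x * (-u) ^ M := by rw [← C_mul, mul_inv_cancel₀ hh, C_1, mul_one, hgeom, mul_sub, mul_one]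
  rw [hid] at hprod
  have : x = (x - x * (-u) ^ M) + x * (-u) ^ M := by ring
  rw [this]
  exact I.add_mem hprod hpowM

/-! ## 2. The master law: one `x_j` is cancelled across the blow-up -/

/-- **Master law.**  For a state of order `≥ p`, a chart `j`, a point `b` with `b_j = 0` and the cleaned
transform `F'`: if `g ∈ J_p⁺(F) + 𝔪₀^M` and `σ_{j,b}^* g = x_j^o · h` with `o ≥ 1`, then
`x_j^{o−1} · h ∈ J_p⁺(F') + (x_j^{M−1})`.  (L2: `σ^*(J_p⁺F) ⊆ (x_j)·J_p⁺(F')`; `σ^*(𝔪₀^M) ⊆ (x_j^M)`; cancel one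
`x_j` in the domain `K[x]`.) [cite: Kollar2007, Theorem 3.76 (char p, m = p)] -/
theorem X_pow_mul_mem_of_aeval_eq (p : ℕ) [Fact p.Prime] [CharP K p] [DecidableEq K] (s : State K)
    (j : Fin 4) (b : Fin 4 → K) (hbj : b j = 0)
    (hord : (p : ℕ∞) ≤ CentreBlowup.ordAlong Finset.univ s.F) {g h : MvPolynomial (Fin 4) K} {o M : ℕ}
    (ho : 1 ≤ o) (hg : g ∈ singLocusIdeal p s.F ⊔ originIdeal K ^ M)
    (hσ : aeval (fun i => if i = j then (X j : MvPolynomial (Fin 4) K) else X j * (X i + C (b i))) g =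
      X j ^ o * h) :
    X j ^ (o - 1) * h ∈ singLocusIdeal p (CentreBlowup.step p Finset.univ j b s).F ⊔
      Ideal.span {(X j : MvPolynomial (Fin 4) K) ^ (M - 1)} := by
  classical
  rcases Nat.eq_zero_or_pos M with hM | hM
  · -- `M = 0`: the right summand is the unit ideal
    subst hM
    apply Ideal.mem_sup_right
    rw [Nat.zero_sub, pow_zero, Ideal.span_singleton_one]
    exact Submodule.mem_top
  obtain ⟨a, ha, r, hr, hgar⟩ := Submodule.mem_sup.mp hg
  -- `σ^* a = x_j · a'` with `a' ∈ J_p⁺(F')`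
  obtain ⟨a', ha', haeq⟩ := Ideal.mem_span_singleton_mul.mp
    (NarrowPullback.aeval_mem_X_mul_singLocusIdeal p s j b hbj hord ha)
  -- `σ^* r = x_j^M · r'`
  have hr' : (X j : MvPolynomial (Fin 4) K) ^ M ∣
      aeval (fun i => if i = j then (X j : MvPolynomial (Fin 4) K) else X j * (X i + C (b i))) r := by
    have h1 := NarrowPullback.map_originIdeal_pow_le j b M (Ideal.mem_map_of_mem _ hr)
    rw [Ideal.mem_span_singleton] at h1
    exact h1
  obtain ⟨r', hreq⟩ := hr'
  -- the identity `x_j^o h = x_j a' + x_j^M r'`, and cancellation of one `x_j`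
  have hid : (X j : MvPolynomial (Fin 4) K) * (X j ^ (o - 1) * h) = X j * (a' + X j ^ (M - 1) * r') := by
    have h1 : (X j : MvPolynomial (Fin 4) K) * (X j ^ (o - 1) * h) = X j ^ o * h := by
      rw [← mul_assoc, ← pow_succ', Nat.sub_add_cancel ho]
    have h2 : (X j : MvPolynomial (Fin 4) K) * (a' + X j ^ (M - 1) * r') = X j * a' + X j ^ M * r' := by
      rw [mul_add, ← mul_assoc, ← pow_succ', Nat.sub_add_cancel hM]
    rw [h1, h2, ← hσ, hgar.symm, map_add, haeq, hreq]
  have hcancel : X j ^ (o - 1) * h = a' + X j ^ (M - 1) * r' :=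
    mul_left_cancel₀ (X_ne_zero j) hid
  rw [hcancel]
  exact Submodule.add_mem_sup ha' (Ideal.mul_mem_right _ _ (Ideal.mem_span_singleton_self _))

/-- `(x_j^{M}) ≤ 𝔪₀^{M}`. [folklore] -/
theorem span_X_pow_le_originIdeal_pow (j : Fin 4) (M : ℕ) :
    Ideal.span {(X j : MvPolynomial (Fin 4) K) ^ M} ≤ originIdeal K ^ M := by
  rw [← Ideal.span_singleton_pow]
  exact Ideal.pow_right_mono ((Ideal.span_singleton_le_iff_mem _).mpr (IsolatedScope.X_mem_originIdeal j)) M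

/-! ## 3. (U): the exceptional length drops -/

/-- **(U) The exceptional length drops by one** (CARD I-3-11 (U); the cancellation step of the (N1) assembly,
CARD I-3-10): for ANY point `b` of the exceptional hyperplane of chart `j` (`b_j = 0`) above a state of order
`≥ p`, `x_j^ℓ ∈ J_p⁺(F) + 𝔪₀^M` implies `x_j^{ℓ−1} ∈ J_p⁺(F') + 𝔪₀^{M−1}`, `F'` the cleaned transform.  Read at
every level: `x_j^ℓ ∈ Ĵ⁺(F) ⇒ x_j^{ℓ−1} ∈ Ĵ⁺(F')`. [cite: Kollar2007, Theorem 3.76 (char p, m = p)] -/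
theorem X_pow_pred_mem_of_X_pow_mem (p : ℕ) [Fact p.Prime] [CharP K p] [DecidableEq K] (s : State K)
    (j : Fin 4) (b : Fin 4 → K) (hbj : b j = 0)
    (hord : (p : ℕ∞) ≤ CentreBlowup.ordAlong Finset.univ s.F) {ℓ M : ℕ} (hℓ : 1 ≤ ℓ)
    (hx : (X j : MvPolynomial (Fin 4) K) ^ ℓ ∈ singLocusIdeal p s.F ⊔ originIdeal K ^ M) :
    (X j : MvPolynomial (Fin 4) K) ^ (ℓ - 1) ∈
      singLocusIdeal p (CentreBlowup.step p Finset.univ j b s).F ⊔ originIdeal K ^ (M - 1) := by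
  have hσ : aeval (fun i => if i = j then (X j : MvPolynomial (Fin 4) K) else X j * (X i + C (b i)))
      ((X j : MvPolynomial (Fin 4) K) ^ ℓ) = X j ^ ℓ * 1 := by
    rw [map_pow, NarrowPullback.aeval_chart_X_self, mul_one]
  have h := X_pow_mul_mem_of_aeval_eq p s j b hbj hord hℓ hx hσ
  rw [mul_one] at h
  exact sup_le_sup_left (span_X_pow_le_originIdeal_pow j (M - 1)) _ h

/-- **(U), all levels at once**: `(∀ M, x_j^ℓ ∈ J_p⁺(F) + 𝔪₀^M) ⇒ ∀ M, x_j^{ℓ−1} ∈ J_p⁺(F') + 𝔪₀^M`.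
[cite: Kollar2007, Theorem 3.76 (char p, m = p)] -/
theorem forall_X_pow_pred_mem_of_forall_X_pow_mem (p : ℕ) [Fact p.Prime] [CharP K p] [DecidableEq K]
    (s : State K) (j : Fin 4) (b : Fin 4 → K) (hbj : b j = 0)
    (hord : (p : ℕ∞) ≤ CentreBlowup.ordAlong Finset.univ s.F) {ℓ : ℕ} (hℓ : 1 ≤ ℓ)
    (hx : ∀ M : ℕ, (X j : MvPolynomial (Fin 4) K) ^ ℓ ∈ singLocusIdeal p s.F ⊔ originIdeal K ^ M)
    (M : ℕ) :
    (X j : MvPolynomial (Fin 4) K) ^ (ℓ - 1) ∈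
      singLocusIdeal p (CentreBlowup.step p Finset.univ j b s).F ⊔ originIdeal K ^ M := by
  have h := X_pow_pred_mem_of_X_pow_mem p s j b hbj hord hℓ (hx (M + 1))
  rwa [Nat.add_sub_cancel] at h

/-! ## 4. (NT): non-tangent moves -/

/-- **(NT) Non-tangent moves** (CARD I-3-11 (NT)): if some `g ∈ J_p⁺(F) + 𝔪₀^M` pulls back to
`σ_{j,b}^* g = x_j^o · h` with `h(0) ≠ 0` (`o ≥ 1`), then `x_j^{o−1} ∈ J_p⁺(F') + 𝔪₀^{M−1}` — for ANY point `b`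
of the exceptional hyperplane (no hypothesis on the successor). [cite: Kollar2007, Theorem 3.76 (char p, m = p)] -/
theorem X_pow_pred_mem_of_aeval_eq_mul_unit (p : ℕ) [Fact p.Prime] [CharP K p] [DecidableEq K]
    (s : State K) (j : Fin 4) (b : Fin 4 → K) (hbj : b j = 0)
    (hord : (p : ℕ∞) ≤ CentreBlowup.ordAlong Finset.univ s.F) {g h : MvPolynomial (Fin 4) K} {o M : ℕ}
    (ho : 1 ≤ o)
    (hg : g ∈ singLocusIdeal p s.F ⊔ originIdeal K ^ M)
    (hσ : aeval (fun i => if i = j then (X j : MvPolynomial (Fin 4) K) else X j * (X i + C (b i))) g =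
      X j ^ o * h)
    (hh : constantCoeff h ≠ 0) :
    (X j : MvPolynomial (Fin 4) K) ^ (o - 1) ∈
      singLocusIdeal p (CentreBlowup.step p Finset.univ j b s).F ⊔ originIdeal K ^ (M - 1) := by
  have h1 := X_pow_mul_mem_of_aeval_eq p s j b hbj hord ho hg hσ
  have h2 : (X j : MvPolynomial (Fin 4) K) ^ (o - 1) * h ∈
      singLocusIdeal p (CentreBlowup.step p Finset.univ j b s).F ⊔ originIdeal K ^ (M - 1) :=
    sup_le_sup_left (span_X_pow_le_originIdeal_pow j (M - 1)) _ h1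
  exact mem_sup_pow_of_mul_mem hh h2

/-- **(NT), all levels at once**: if for every `M` some `g_M ∈ J_p⁺(F) + 𝔪₀^M` pulls back to
`x_j^o ·`(a polynomial with non-zero constant term), then `x_j^{o−1} ∈ J_p⁺(F') + 𝔪₀^M` for every `M`.
[cite: Kollar2007, Theorem 3.76 (char p, m = p)] -/
theorem forall_X_pow_pred_mem_of_aeval_eq_mul_unit (p : ℕ) [Fact p.Prime] [CharP K p] [DecidableEq K]
    (s : State K) (j : Fin 4) (b : Fin 4 → K) (hbj : b j = 0)
    (hord : (p : ℕ∞) ≤ CentreBlowup.ordAlong Finset.univ s.F) {o : ℕ} (ho : 1 ≤ o)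
    (hg : ∀ M : ℕ, ∃ g h : MvPolynomial (Fin 4) K, g ∈ singLocusIdeal p s.F ⊔ originIdeal K ^ M ∧
      aeval (fun i => if i = j then (X j : MvPolynomial (Fin 4) K) else X j * (X i + C (b i))) g =
        X j ^ o * h ∧ constantCoeff h ≠ 0)
    (M : ℕ) :
    (X j : MvPolynomial (Fin 4) K) ^ (o - 1) ∈
      singLocusIdeal p (CentreBlowup.step p Finset.univ j b s).F ⊔ originIdeal K ^ M := by
  obtain ⟨g, h, hgM, hσ, hh⟩ := hg (M + 1)
  have h1 := X_pow_pred_mem_of_aeval_eq_mul_unit p s j b hbj hord ho hgM hσ hh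
  rwa [Nat.add_sub_cancel] at h1

end ExceptionalLength

end Summit.ResolutionOfSingularities.ResolutionOfSingularities.Theorems.PIDim4
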